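import Literature.MathematicalPhysics.QuantumFieldTheory.OSHolomorphicVectors
import Literature.MathematicalPhysics.QuantumFieldTheory.OSEnvelopeBases
import Literature.Analysis.Complex.SectorPolydiscCharts
import HarnessLib

/-!
# The vectors `Ψₙ(x, ζ)` of OS II on the regions `D_n^{(N)}` (the step (A_N) ⇒ (P_N), concretely)

Topic `Literature/MathematicalPhysics/QuantumFieldTheory`; support file (all proved, one auxiliary
definition `cDiagEmbed`, no named facts) for the discharge of (A1)
`OS1975_exists_timeContinuation`. It specialises the abstract engine
`exists_holomorphic_gramVec` (`OSHolomorphicVectors`) to the regions of Osterwalder–Schrader II,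
Ch. V.2, (5.16)–(5.17), (5.24): with the bases `d_m^{(N)} = osBaseD N m` of `OSEnvelopeBases`,

  `D^{(N)}(x) = {ζ ∈ ℂ₊ᵐ | (arg ζᵢ)ᵢ ∈ d_m^{(N)}}`  (the `ζ`-section of `D_{m+1}^{(N)}` at `x > 0`),

and a function `S` (the level-`N` continuation `S_{2m+1}`… in OS's count `S_{2n-1}`, `n = m + 1`)
holomorphic on the argument region of `c^{(N)}_{m+1+m} = osBaseC N (m+1+m)`: if vectors `Φ(η)` at
the positive real points have the Gram kernel
`⟪Φ η', Φ η⟫ = S(η'_{m-1}, …, η'_0, 2x, η_0, …, η_{m-1})` (OS (5.17) at real points, i.e. (P_0)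
transported to level `N`, "`S_k(ζ) = (Ω, Ψ_{k+1}(x, ζ))`"), then there is a holomorphic `H`-valued
`Ψ` on `D^{(N)}(x)` extending `Φ`, with `‖Ψ ζ‖² = Re S(θζ, 2x, ζ)` (`θζ` = reversed complex
conjugate; OS (5.21)) and the continued Gram identity on polydisc charts
(`OSEnvelope.exists_osVectors`). The chart hypothesis of the engine is OS's remark before (5.19),
here `exists_polydisc_chart_of_argSolid` (`SectorPolydiscCharts`) fed with the openness
(`isOpen_osBaseD_succ`), solidity (`osBaseD_solid`, `osBaseC_solid`) and the cube bound
(`osBaseD_subset_cube`) of the bases; the kernel `k(w, z) = S(cDiagEmbed w (2x) z)` is holomorphic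
on the chart squares because `S` is, `cDiagEmbed` being affine.

## References

* K. Osterwalder, R. Schrader, *Axioms for Euclidean Green's functions II*, Comm. Math. Phys. 42
  (1975) 281–305, Ch. V.2 (5.16)–(5.21), (5.24). [OsterwalderSchraderCMP1975]
-/

noncomputable section

open Metric Set Filter Complex
open scoped Topology ComplexConjugate InnerProductSpace

namespace Literature.MathematicalPhysics.QuantumFieldTheory.OSEnvelope

open Literature.Analysis.Complex Literature.MathematicalPhysics.QuantumFieldTheory

variable {m : ℕ}

/-! ### The complex diagonal placement `(w̃, t, z)` -/

/-- **The diagonal placement** `cDiagEmbed w t z = (w_{m-1}, …, w_0, t, z_0, …, z_{m-1})` of two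
`m`-vectors around a middle slot (no conjugation): with `w = z̄` and `t = 2x` this is OS II's
argument `(θζ, 2x, ζ)` of `S_{2n-1}` in (5.16)–(5.17), and its vector of arguments is
`dEmbed (arg ∘ z)` ((5.24)). [cite: OsterwalderSchraderCMP1975, Ch. V.2 eqs. (5.16)–(5.17)] -/
def cDiagEmbed (w : Fin m → ℂ) (t : ℂ) (z : Fin m → ℂ) : Fin (m + 1 + m) → ℂ :=
  fun i => if h : (i : ℕ) < m then w ⟨m - 1 - i, by omega⟩
    else if h' : (i : ℕ) = m then t else z ⟨i - m - 1, by have := i.2; omega⟩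

/-- Left block. [folklore] -/
theorem cDiagEmbed_apply_lt (w : Fin m → ℂ) (t : ℂ) (z : Fin m → ℂ) {i : Fin (m + 1 + m)}
    (h : (i : ℕ) < m) : cDiagEmbed w t z i = w ⟨m - 1 - i, by omega⟩ := by
  simp [cDiagEmbed, h]

/-- Middle slot. [folklore] -/
theorem cDiagEmbed_apply_mid (w : Fin m → ℂ) (t : ℂ) (z : Fin m → ℂ) {i : Fin (m + 1 + m)}
    (h : (i : ℕ) = m) : cDiagEmbed w t z i = t := by
  simp [cDiagEmbed, h]

/-- Right block. [folklore] -/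
theorem cDiagEmbed_apply_gt (w : Fin m → ℂ) (t : ℂ) (z : Fin m → ℂ) {i : Fin (m + 1 + m)}
    (h : m < (i : ℕ)) : cDiagEmbed w t z i = z ⟨i - m - 1, by have := i.2; omega⟩ := by
  have h1 : ¬ (i : ℕ) < m := by omega
  have h2 : ¬ (i : ℕ) = m := by omega
  simp [cDiagEmbed, h1, h2]

/-- `cDiagEmbed` is affine in `(w, z)`: a continuous linear map plus a constant. [folklore] -/
theorem cDiagEmbed_eq_add (w : Fin m → ℂ) (t : ℂ) (z : Fin m → ℂ) :
    cDiagEmbed w t z = cDiagEmbed w 0 z + cDiagEmbed 0 t 0 := by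
  funext i
  simp only [cDiagEmbed, Pi.add_apply]
  split_ifs <;> simp

/-- The linear part of `cDiagEmbed` as a continuous linear map of the pair `(w, z)`. [folklore] -/
def cDiagEmbedCLM (m : ℕ) : ((Fin m → ℂ) × (Fin m → ℂ)) →L[ℂ] (Fin (m + 1 + m) → ℂ) :=
  ContinuousLinearMap.pi fun i =>
    if h : (i : ℕ) < m then (ContinuousLinearMap.proj ⟨m - 1 - i, by omega⟩).comp
        (ContinuousLinearMap.fst ℂ (Fin m → ℂ) (Fin m → ℂ))
    else if h' : (i : ℕ) = m then 0
    else (ContinuousLinearMap.proj ⟨i - m - 1, by have := i.2; omega⟩).comp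
        (ContinuousLinearMap.snd ℂ (Fin m → ℂ) (Fin m → ℂ))

/-- The continuous linear map is `cDiagEmbed · 0 ·`. [folklore] -/
theorem cDiagEmbedCLM_apply (p : (Fin m → ℂ) × (Fin m → ℂ)) :
    cDiagEmbedCLM m p = cDiagEmbed p.1 0 p.2 := by
  funext i
  simp only [cDiagEmbedCLM, ContinuousLinearMap.pi_apply, cDiagEmbed]
  split_ifs <;> simp

/-- `(w, z) ↦ cDiagEmbed w t z` is complex-differentiable. [folklore] -/
theorem differentiable_cDiagEmbed (t : ℂ) :
    Differentiable ℂ fun p : (Fin m → ℂ) × (Fin m → ℂ) => cDiagEmbed p.1 t p.2 := by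
  have : (fun p : (Fin m → ℂ) × (Fin m → ℂ) => cDiagEmbed p.1 t p.2) =
      fun p => cDiagEmbedCLM m p + cDiagEmbed 0 t 0 := by
    funext p; rw [cDiagEmbedCLM_apply, ← cDiagEmbed_eq_add]
  rw [this]
  exact (cDiagEmbedCLM m).differentiable.add (differentiable_const _)

/-! ### Real parts and arguments of the placed vector -/

/-- All entries of `cDiagEmbed w t z` have positive real part when those of `w`, `z` and `t` do. [folklore] -/
theorem re_cDiagEmbed_pos {w z : Fin m → ℂ} {t : ℂ} (hw : ∀ i, 0 < (w i).re) (ht : 0 < t.re)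
    (hz : ∀ i, 0 < (z i).re) (i : Fin (m + 1 + m)) : 0 < (cDiagEmbed w t z i).re := by
  rcases lt_trichotomy (i : ℕ) m with h | h | h
  · rw [cDiagEmbed_apply_lt _ _ _ h]; exact hw _
  · rw [cDiagEmbed_apply_mid _ _ _ h]; exact ht
  · rw [cDiagEmbed_apply_gt _ _ _ h]; exact hz _

/-- **The arguments of the placed vector are dominated by `dEmbed φ`** when `|arg wᵢ|, |arg zᵢ| ≤ φᵢ`
and `t > 0`: `|arg (cDiagEmbed w t z)ᵢ| ≤ |(dEmbed φ)ᵢ|`. [folklore] -/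
theorem abs_arg_cDiagEmbed_le {w z : Fin m → ℂ} {t : ℝ} (ht : 0 < t) {φ : Fin m → ℝ}
    (hw : ∀ i, |(w i).arg| ≤ φ i) (hz : ∀ i, |(z i).arg| ≤ φ i) (i : Fin (m + 1 + m)) :
    |(cDiagEmbed w (t : ℂ) z i).arg| ≤ |dEmbed φ i| := by
  rcases lt_trichotomy (i : ℕ) m with h | h | h
  · rw [cDiagEmbed_apply_lt _ _ _ h]
    simp only [dEmbed, h, dif_pos, abs_neg]
    exact (hw _).trans (le_abs_self _)
  · rw [cDiagEmbed_apply_mid _ _ _ h, Complex.arg_ofReal_of_nonneg ht.le, abs_zero]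
    exact abs_nonneg _
  · rw [cDiagEmbed_apply_gt _ _ _ h]
    have h1 : ¬ (i : ℕ) < m := by omega
    have h2 : ¬ (i : ℕ) = m := by omega
    simp only [dEmbed, h1, h2, dif_neg, not_false_eq_true]
    exact (hz _).trans (le_abs_self _)

/-! ### The vectors on `D^{(N)}(x)` -/

/-- **The vectors `Ψ(x, ζ)` of OS II on the region `D^{(N)}(x) = {ζ ∈ ℂ₊ᵐ | (arg ζᵢ)ᵢ ∈ d_m^{(N)}}`**
(the step (A_N) ⇒ (P_N) of Ch. V.2 for OS's own regions, `N ≥ 1`). Let `S` be holomorphic on the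
argument region of `c^{(N)}_{m+1+m}` and let vectors `Φ(η)` at the positive real points have the
Gram kernel `⟪Φ η', Φ η⟫ = S(cDiagEmbed η' (2x) η)` ((5.17) at real points). Then there is
`Ψ`, holomorphic `H`-valued on `D^{(N)}(x)`, equal to `Φ` at the positive real points, with values
in the closed span of the `Φ(η)`, with `‖Ψ ζ‖² = Re S(cDiagEmbed ζ̄ (2x) ζ)` ((5.21)), and with the
Gram identity `⟪Ψ w, Ψ z⟫ = S(cDiagEmbed w̄ (2x) z)` for `w, z` in a polydisc chart about every
point. [cite: OsterwalderSchraderCMP1975, Ch. V.2 (5.16)–(5.21)] -/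
theorem exists_osVectors {H : Type*} [NormedAddCommGroup H] [InnerProductSpace ℂ H]
    [CompleteSpace H] {N : ℕ} {S : (Fin (m + 1 + m) → ℂ) → ℂ}
    (hS : DifferentiableOn ℂ S
      {Z | (∀ i, 0 < (Z i).re) ∧ (fun i => (Z i).arg) ∈ osBaseC (N + 1) (m + 1 + m)})
    {x : ℝ} (hx : 0 < x) {Φ : (Fin m → ℝ) → H}
    (hGram : ∀ η η' : Fin m → ℝ, (∀ i, 0 < η i) → (∀ i, 0 < η' i) →
      ⟪Φ η', Φ η⟫_ℂ = S (cDiagEmbed (fun i => (η' i : ℂ)) ((2 * x : ℝ) : ℂ) (fun i => (η i : ℂ)))) :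
    ∃ Ψ : (Fin m → ℂ) → H,
      DifferentiableOn ℂ Ψ {ζ | (∀ i, 0 < (ζ i).re) ∧ (fun i => (ζ i).arg) ∈ osBaseD (N + 1) m} ∧
      (∀ η : Fin m → ℝ, (∀ i, 0 < η i) → Ψ (fun i => (η i : ℂ)) = Φ η) ∧
      (∀ ζ ∈ {ζ : Fin m → ℂ | (∀ i, 0 < (ζ i).re) ∧ (fun i => (ζ i).arg) ∈ osBaseD (N + 1) m},
        Ψ ζ ∈ (Submodule.span ℂ (Φ '' {η | ∀ i, 0 < η i})).topologicalClosure) ∧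
      (∀ ζ ∈ {ζ : Fin m → ℂ | (∀ i, 0 < (ζ i).re) ∧ (fun i => (ζ i).arg) ∈ osBaseD (N + 1) m},
        ‖Ψ ζ‖ ^ 2 = (S (cDiagEmbed (star ζ) ((2 * x : ℝ) : ℂ) ζ)).re) ∧
      ∀ ζ ∈ {ζ : Fin m → ℂ | (∀ i, 0 < (ζ i).re) ∧ (fun i => (ζ i).arg) ∈ osBaseD (N + 1) m},
        ∃ (ξ r : Fin m → ℝ), (∀ i, 0 < r i) ∧ ζ ∈ polydisc (fun i => (ξ i : ℂ)) r ∧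
          polydisc (fun i => (ξ i : ℂ)) r ⊆
            {ζ : Fin m → ℂ | (∀ i, 0 < (ζ i).re) ∧ (fun i => (ζ i).arg) ∈ osBaseD (N + 1) m} ∧
          ∀ w ∈ polydisc (fun i => (ξ i : ℂ)) r, ∀ z ∈ polydisc (fun i => (ξ i : ℂ)) r,
            ⟪Ψ w, Ψ z⟫_ℂ = S (cDiagEmbed (star w) ((2 * x : ℝ) : ℂ) z) := by
  set Ω : Set (Fin m → ℂ) :=
    {ζ | (∀ i, 0 < (ζ i).re) ∧ (fun i => (ζ i).arg) ∈ osBaseD (N + 1) m} with hΩ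
  set k : (Fin m → ℂ) → (Fin m → ℂ) → ℂ := fun w z => S (cDiagEmbed w ((2 * x : ℝ) : ℂ) z) with hk
  have h2x : 0 < 2 * x := by positivity
  -- real points of `Ω` are exactly the positive points
  have hreal : ∀ η : Fin m → ℝ, (fun i => (η i : ℂ)) ∈ Ω ↔ ∀ i, 0 < η i := by
    intro η
    constructor
    · intro h i; simpa using h.1 i
    · intro h
      refine ⟨fun i => by simpa using h i, ?_⟩
      show (fun i => ((η i : ℂ)).arg) ∈ osBaseD (N + 1) m
      rw [show (fun i => ((η i : ℂ)).arg) = 0 from funext fun i => Complex.arg_ofReal_of_nonneg (h i).le]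
      exact isOSBaseFamily_osBase.zero_mem_D (N + 1) m
  -- charts
  have hchart : ∀ ζ ∈ Ω, ∃ ξ r : Fin m → ℝ, ζ ∈ polydisc (fun i => (ξ i : ℂ)) r ∧ (∀ i, 0 < r i) ∧
      polydisc (fun i => (ξ i : ℂ)) r ⊆ Ω ∧
      DifferentiableOn ℂ (Function.uncurry k)
        (polydisc (fun i => (ξ i : ℂ)) r ×ˢ polydisc (fun i => (ξ i : ℂ)) r) := by
    intro ζ hζ
    obtain ⟨ξ, r, φ, -, hr, hφD, hφ0, hζP, hP⟩ := exists_polydisc_chart_of_argSolid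
      (isOpen_osBaseD_succ N m) (fun v hv w hw => osBaseD_solid hv hw) (osBaseD_subset_cube _ _)
      hζ.1 hζ.2
    have hPΩ : polydisc (fun i => (ξ i : ℂ)) r ⊆ Ω := by
      intro z hz
      refine ⟨fun i => (hP z hz i).1, ?_⟩
      show (fun i => (z i).arg) ∈ osBaseD (N + 1) m
      exact osBaseD_solid hφD fun i => by
        rw [abs_of_pos (hφ0 i)]; exact (hP z hz i).2.le
    refine ⟨ξ, r, hζP, hr, hPΩ, ?_⟩
    -- `k` is holomorphic on `P × P`: `S ∘ cDiagEmbed`, the placed vectors staying in the region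
    have hmaps : ∀ p ∈ polydisc (fun i => (ξ i : ℂ)) r ×ˢ polydisc (fun i => (ξ i : ℂ)) r,
        cDiagEmbed p.1 ((2 * x : ℝ) : ℂ) p.2 ∈
          {Z : Fin (m + 1 + m) → ℂ | (∀ i, 0 < (Z i).re) ∧
            (fun i => (Z i).arg) ∈ osBaseC (N + 1) (m + 1 + m)} := by
      rintro ⟨w, z⟩ ⟨hw, hz⟩
      refine ⟨re_cDiagEmbed_pos (fun i => (hP w hw i).1) (by simpa using h2x)
        (fun i => (hP z hz i).1), ?_⟩
      have hφC : dEmbed φ ∈ osBaseC (N + 1) (m + 1 + m) := (mem_osBaseD_iff φ).1 hφD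
      exact osBaseC_solid hφC (abs_arg_cDiagEmbed_le h2x (fun i => (hP w hw i).2.le)
        (fun i => (hP z hz i).2.le))
    have hcomp := hS.comp (differentiable_cDiagEmbed ((2 * x : ℝ) : ℂ)).differentiableOn hmaps
    exact hcomp
  -- the Gram identity at real points
  have hGramΩ : ∀ η η' : Fin m → ℝ, (fun i => (η i : ℂ)) ∈ Ω → (fun i => (η' i : ℂ)) ∈ Ω →
      ⟪Φ η', Φ η⟫_ℂ = k (fun i => (η' i : ℂ)) (fun i => (η i : ℂ)) := fun η η' hη hη' =>
    hGram η η' ((hreal η).1 hη) ((hreal η').1 hη')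
  obtain ⟨Ψ, hhol, hre, hmem, hgram⟩ := exists_holomorphic_gramVec hchart hGramΩ
  have himg : {η : Fin m → ℝ | (fun i => (η i : ℂ)) ∈ Ω} = {η | ∀ i, 0 < η i} :=
    Set.ext fun η => hreal η
  refine ⟨Ψ, hhol, fun η hη => hre η ((hreal η).2 hη), fun ζ hζ => himg ▸ hmem ζ hζ,
    fun ζ hζ => ?_, fun ζ hζ => ?_⟩
  · obtain ⟨ξ, r, hζP, hr, hPΩ, hkd⟩ := hchart ζ hζ
    exact norm_sq_eq_re_of_gram (k := k) (hgram ξ r hr hPΩ hkd ζ hζP ζ hζP)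
  · obtain ⟨ξ, r, hζP, hr, hPΩ, hkd⟩ := hchart ζ hζ
    exact ⟨ξ, r, hr, hζP, hPΩ, fun w hw z hz => hgram ξ r hr hPΩ hkd w hw z hz⟩

end Literature.MathematicalPhysics.QuantumFieldTheory.OSEnvelope
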